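import Mathlib
import Summits.SmoothPoincare4.SmoothPoincare4.Theses.SullivanDual
import Summits.SmoothPoincare4.SmoothPoincare4.Theorems.SullivanDualAdmissibleJExists
import Summits.SmoothPoincare4.SmoothPoincare4.Theorems.SullivanDualAdmissibleJExistsCoframes
import Literature.Geometry.Symplectic.JHolomorphicMap
import HarnessLib

/-!
# Crux `HyperbolicEnd` (stmt-SmoothPoincare4-7825), line `Sketch` — stub `stub_transportToChart`
# (G1, transport to the chart)

Transport of the puncture-certificate data `(J, F)` of a punctured homotopy 4-sphere by the chart
`e_q = extChartAt q` to a flat pair `(Ĵ, F̂)` on the chart ball `B(e_q q, r₃) ⊂ ℝ⁴`: `Ĵ` smooth and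
almost complex on the ball, `F̂` smooth and positive definite on the shell, flat certificate on the
shell, linked to `(J, F)` through the chart differential `A_x = D(e_q ∘ val)(x)`.

* §1 (any `C^∞` manifold `N` over a complete model, `q' ∈ N`, `A_x = D(e_{q'})(x)`): on the chart
  domain of `q'`, `x ↦ τ_{x→x₀} ∘ A_x⁻¹` is `C^∞` at `x₀` (it is the pointwise inverse of the
  reading `A_x ∘ τ_{x₀→x}` of the coframe `A` in the tangent coordinates at `x₀`, `τ` the tangent
  coordinate changes), hence so are the conjugate `x ↦ A_x J_x A_x⁻¹` of a smooth field of tangent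
  endomorphisms `J` (cocycle rule) and `(y, w) ↦ F(Φ y)(A_{Φ y}⁻¹ w)` for `F` smooth on `TN` and
  `Φ` smooth into the chart domain (`contMDiffAt_totalSpace`).
* §2 the stub: `Ĵ y = A_x J_x A_x⁻¹`, `F̂ y w = F_x(A_x⁻¹ w)` with `x = e_q⁻¹ y`; a flat
  `Ĵ`-holomorphic `g` into the shell lifts to the `J`-holomorphic `f = e_q⁻¹ ∘ g` into the core
  minus the inner ball, with the same density, so the manifold certificate transfers.
-/

noncomputable section

-- the prescribed crux namespace repeats the component `SmoothPoincare4`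
set_option linter.dupNamespace false

open scoped Manifold ContDiff Topology
open Laplacian Set Filter Function ContinuousLinearMap
open Literature.Geometry.Symplectic Literature.Topology.FourManifolds
open Summit.SmoothPoincare4.SmoothPoincare4.Theorems.SullivanDual

namespace Summit.SmoothPoincare4.SmoothPoincare4.Cruxes.HyperbolicEnd.Sketch

/-! ### §1 Conjugating by the chart differential: smoothness -/

section ChartConj

variable {EN : Type*} [NormedAddCommGroup EN] [NormedSpace ℝ EN] [CompleteSpace EN]
  {HN : Type*} [TopologicalSpace HN] {I : ModelWithCorners ℝ EN HN}
  {N : Type*} [TopologicalSpace N] [ChartedSpace HN N] [IsManifold I ∞ N]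
  {q' : N} {A : N → EN →L[ℝ] EN}

/-- **`x ↦ τ_{x→x₀} ∘ A_x⁻¹` is `C^∞` at `x₀`** on the chart domain of `q'` (`A_x = D(e_{q'})(x)`,
`τ` the tangent coordinate changes): it is the pointwise inverse of the reading `A_x ∘ τ_{x₀→x}`
of the coframe `A` in the tangent coordinates at `x₀`, which is `C^∞`
(`ContMDiffAt.mfderiv_const`) and invertible at `x₀`. -/
theorem contMDiffAt_tangentCoordChange_comp_inverse_chartMfderiv
    (hA : ∀ x, A x = mfderiv I 𝓘(ℝ, EN) (extChartAt I q') x) {x₀ : N}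
    (hx₀ : x₀ ∈ (chartAt HN q').source) :
    ContMDiffAt I 𝓘(ℝ, EN →L[ℝ] EN) ∞
      (fun x => tangentCoordChange I x x₀ x ∘L (A x).inverse) x₀ := by
  have hA' : A = fun x => mfderiv I 𝓘(ℝ, EN) (extChartAt I q') x := funext hA
  have hΨ : ContMDiffAt I 𝓘(ℝ, EN →L[ℝ] EN) ∞
      (inTangentCoordinates I 𝓘(ℝ, EN) (id : N → N) (extChartAt I q') A x₀) x₀ := by
    rw [hA']
    exact (contMDiffAt_extChartAt' (n := ∞) hx₀).mfderiv_const (by simp)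
  have hinv : (A x₀).IsInvertible := by
    rw [hA]
    exact isInvertible_mfderiv_extChartAt (by rwa [extChartAt_source])
  refine (contMDiffAt_inverse_inTangentCoordinates_coframe A (extChartAt I q') hΨ
    hinv).congr_of_eventuallyEq ?_
  filter_upwards [(chartAt HN x₀).open_source.mem_nhds (mem_chart_source HN x₀)] with x hx
  have hx' : x ∈ (extChartAt I x₀).source := by rwa [extChartAt_source]
  rw [inTangentCoordinates_coframe_eq A (extChartAt I q') hx, inverse_comp_tangentCoordChange hx']

/-- **Smoothness of `x ↦ A_x J_x A_x⁻¹` on the chart domain of `q'`**, `A_x = D(e_{q'})(x)` and `J`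
a field of tangent endomorphisms smooth in tangent coordinates: near `x₀` it is the product of
the reading `A_x ∘ τ_{x₀→x}` of `A`, the reading `τ_{x→x₀} ∘ J_x ∘ τ_{x₀→x}` of `J` and
`τ_{x→x₀} ∘ A_x⁻¹` (cocycle rule: `τ_{x₀→x} τ_{x→x₀} = 1`), all three `C^∞` at `x₀`. -/
theorem contMDiffAt_conj_chartMfderiv (hA : ∀ x, A x = mfderiv I 𝓘(ℝ, EN) (extChartAt I q') x)
    (J : N → EN →L[ℝ] EN)
    (hJs : ∀ x₀ : N, ContMDiffAt I 𝓘(ℝ, EN →L[ℝ] EN) ∞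
      (inTangentCoordinates I I (id : N → N) id J x₀) x₀)
    {x₀ : N} (hx₀ : x₀ ∈ (chartAt HN q').source) :
    ContMDiffAt I 𝓘(ℝ, EN →L[ℝ] EN) ∞ (fun x => A x ∘L J x ∘L (A x).inverse) x₀ := by
  have hA' : A = fun x => mfderiv I 𝓘(ℝ, EN) (extChartAt I q') x := funext hA
  have hΨ : ContMDiffAt I 𝓘(ℝ, EN →L[ℝ] EN) ∞
      (inTangentCoordinates I 𝓘(ℝ, EN) (id : N → N) (extChartAt I q') A x₀) x₀ := by
    rw [hA']
    exact (contMDiffAt_extChartAt' (n := ∞) hx₀).mfderiv_const (by simp)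
  refine ((hΨ.clm_comp (hJs x₀)).clm_comp
    (contMDiffAt_tangentCoordChange_comp_inverse_chartMfderiv hA hx₀)).congr_of_eventuallyEq ?_
  filter_upwards [(chartAt HN x₀).open_source.mem_nhds (mem_chart_source HN x₀)] with x hx
  have hx' : x ∈ (extChartAt I x₀).source := by rwa [extChartAt_source]
  obtain ⟨e, he', hes'⟩ := exists_equiv_tangentCoordChange (I := I) hx'
  have k : inTangentCoordinates I I (id : N → N) id J x₀ x =
      (e.symm : EN →L[ℝ] EN) ∘L J x ∘L (e : EN →L[ℝ] EN) := by
    rw [inTangentCoordinates_eq _ _ _ hx hx, he', hes']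
    rfl
  rw [inTangentCoordinates_coframe_eq A (extChartAt I q') hx, k, ← he', ← hes']
  ext v
  simp

/-- **`(y, w) ↦ F(Φ y)(A_{Φ y}⁻¹ w)` is `C^∞`** at `(y₀, w₀)` when `F` is `C^∞` on the tangent
bundle `TN`, `Φ` is `C^∞` at `y₀` and `Φ y₀` lies in the chart domain of `q'`
(`A_x = D(e_{q'})(x)`): the map `(y, w) ↦ (Φ y, A_{Φ y}⁻¹ w) ∈ TN` read in the trivialisation of
`TN` at `Φ y₀` is `(Φ y, τ_{Φ y→Φ y₀} A_{Φ y}⁻¹ w)`, smooth by the first lemma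
(`contMDiffAt_totalSpace`). -/
theorem contMDiffAt_apply_inverse_chartMfderiv {G : Type*} [NormedAddCommGroup G]
    [NormedSpace ℝ G] (hA : ∀ x, A x = mfderiv I 𝓘(ℝ, EN) (extChartAt I q') x)
    (F : ∀ x : N, TangentSpace I x → ℝ)
    (hF : ContMDiff I.tangent 𝓘(ℝ, ℝ) ∞ (fun v : TangentBundle I N => F v.proj v.snd))
    {Φ : G → N} {y₀ : G} (hΦ : ContMDiffAt 𝓘(ℝ, G) I ∞ Φ y₀)
    (hx₀ : Φ y₀ ∈ (chartAt HN q').source) (w₀ : EN) :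
    ContMDiffAt 𝓘(ℝ, G × EN) 𝓘(ℝ, ℝ) ∞
      (fun yw : G × EN => F (Φ yw.1) ((A (Φ yw.1)).inverse yw.2)) (y₀, w₀) := by
  have h1 : ContMDiffAt 𝓘(ℝ, G × EN) I ∞ (fun yw : G × EN => Φ yw.1) (y₀, w₀) :=
    hΦ.comp (y₀, w₀) contDiffAt_fst.contMDiffAt
  have h2 : ContMDiffAt 𝓘(ℝ, G × EN) 𝓘(ℝ, EN) ∞
      (fun yw : G × EN => tangentCoordChange I (Φ yw.1) (Φ y₀) (Φ yw.1)
        ((A (Φ yw.1)).inverse yw.2)) (y₀, w₀) :=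
    ((contMDiffAt_tangentCoordChange_comp_inverse_chartMfderiv hA hx₀).comp (y₀, w₀) h1).clm_apply
      contDiffAt_snd.contMDiffAt
  have hΛ : ContMDiffAt 𝓘(ℝ, G × EN) I.tangent ∞
      (fun yw : G × EN => (Bundle.TotalSpace.mk' EN (Φ yw.1)
        ((A (Φ yw.1)).inverse yw.2) : TangentBundle I N)) (y₀, w₀) := by
    rw [Bundle.contMDiffAt_totalSpace]
    exact ⟨h1, h2⟩
  exact hF.contMDiffAt.comp (y₀, w₀) hΛ

end ChartConj

/-! ### §2 The stub -/

/-- **Stub `stub_transportToChart` (G1, transport to the chart).** With `a = e_q q`,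
`x(y) = e_q⁻¹ y ∈ Σ ∖ p` for `y` in the closed chart ball (the point `q` elsewhere) and
`A_x = D(e_q ∘ val)(x)` (the differential of the chart of the open submanifold `Σ ∖ p` at `q`,
invertible on the chart domain), put `Ĵ y = A_{x(y)} J_{x(y)} A_{x(y)}⁻¹` and
`F̂ y w = F_{x(y)}(A_{x(y)}⁻¹ w)`. Then `Ĵ` is `C^∞` on `B(a, r₃)` with `Ĵ² = -1` and `F̂` is `C^∞`
on the shell times `ℝ⁴` (§1 composed with the smooth inverse chart) and positive definite there;
a flat `Ĵ`-holomorphic `g : U → shell` lifts to `f = x ∘ g`, `C^∞` and `J`-holomorphic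
(`Dg = A_f ∘ Df` by the chain rule, `A` injective) into the core (the closed chart ball misses the
collar) avoiding the inner closed ball, whose `F`-density equals the `F̂`-density of `g` on `U`,
so the manifold certificate transfers (`ContDiffOn.congr`, `laplacian_congr_nhds`,
`EventuallyEq.fderiv_eq`); finally `x(e_q x) = x` on the chart domain gives the link. -/
theorem stub_transportToChart :
    ∀ (S : HomotopySphere 4) (p : S.carrier)
    (J : ∀ x : ↥(punctured p), TangentSpace (𝓡 4) x →L[ℝ] TangentSpace (𝓡 4) x) (ε' : ℝ)
    (F : ∀ x : ↥(punctured p), TangentSpace (𝓡 4) x → ℝ) (c : ℝ) (q : S.carrier) (r₁ r₃ : ℝ),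
    (0 < ε' ∧ Metric.closedBall (extChartAt (𝓡 4) p p) ε' ⊆ (extChartAt (𝓡 4) p).target ∧
      (∀ (x : ↥(punctured p)) (v : TangentSpace (𝓡 4) x), J x (J x v) = -v) ∧
      (∀ x₀ : ↥(punctured p), ContMDiffAt (𝓡 4)
        𝓘(ℝ, EuclideanSpace ℝ (Fin 4) →L[ℝ] EuclideanSpace ℝ (Fin 4)) ∞
        (inTangentCoordinates (𝓡 4) (𝓡 4) (id : ↥(punctured p) → ↥(punctured p)) id
          (fun x => J x) x₀) x₀) ∧
      (∀ x : ↥(punctured p), InPuncturedChartBall p ε' x →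
        ∀ (v : TangentSpace (𝓡 4) x) (b : EuclideanSpace ℝ (Fin 4)),
          inner ℝ (fderiv ℝ inversion (extChartAt (𝓡 4) p x.1 - extChartAt (𝓡 4) p p)
            (mfderiv (𝓡 4) 𝓘(ℝ, EuclideanSpace ℝ (Fin 4))
              (fun z : ↥(punctured p) => extChartAt (𝓡 4) p z.1) x (J x v))) b =
          stdSymplecticForm (fderiv ℝ inversion (extChartAt (𝓡 4) p x.1 - extChartAt (𝓡 4) p p)
            (mfderiv (𝓡 4) 𝓘(ℝ, EuclideanSpace ℝ (Fin 4))
              (fun z : ↥(punctured p) => extChartAt (𝓡 4) p z.1) x v)) b) ∧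
      0 < c ∧ 0 < r₁ ∧ r₁ < r₃ ∧
      Metric.closedBall (extChartAt (𝓡 4) q q) r₃ ⊆ (extChartAt (𝓡 4) q).target ∧
      (∀ y ∈ Metric.closedBall (extChartAt (𝓡 4) q q) r₃, (extChartAt (𝓡 4) q).symm y ≠ p) ∧
      (∀ x : ↥(punctured p), x.1 ∈ (chartAt (EuclideanSpace ℝ (Fin 4)) q).source →
        extChartAt (𝓡 4) q x.1 ∈ Metric.closedBall (extChartAt (𝓡 4) q q) r₃ →
        ¬ InPuncturedChartBall p ε' x) ∧
      ContMDiff (𝓡 4).tangent 𝓘(ℝ, ℝ) ∞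
        (fun v : TangentBundle (𝓡 4) ↥(punctured p) => F v.proj v.snd) ∧
      (∀ (x : ↥(punctured p)) (v : TangentSpace (𝓡 4) x), 0 ≤ F x v ∧ (F x v = 0 → v = 0)) ∧
      (∀ (U : Set ℂ) (f : ℂ → ↥(punctured p)), IsOpen U →
        ContMDiffOn 𝓘(ℝ, ℂ) (𝓡 4) ∞ f U →
        (∀ z ∈ U, ∀ ζ : ℂ, mfderiv 𝓘(ℝ, ℂ) (𝓡 4) f z (Complex.I * ζ : ℂ) =
          J (f z) (mfderiv 𝓘(ℝ, ℂ) (𝓡 4) f z (ζ : ℂ))) →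
        (∀ z ∈ U, ¬ InPuncturedChartBall p ε' (f z)) →
        (∀ z ∈ U, (f z).1 ∈ (chartAt (EuclideanSpace ℝ (Fin 4)) q).source →
            extChartAt (𝓡 4) q (f z).1 ∉ Metric.closedBall (extChartAt (𝓡 4) q q) r₁) →
        ContDiffOn ℝ 2 (fun w => F (f w) (mfderiv 𝓘(ℝ, ℂ) (𝓡 4) f w (1 : ℂ))) U ∧
        ∀ z ∈ U, 2 * c * (F (f z) (mfderiv 𝓘(ℝ, ℂ) (𝓡 4) f z (1 : ℂ))) ^ 3 ≤
          F (f z) (mfderiv 𝓘(ℝ, ℂ) (𝓡 4) f z (1 : ℂ)) *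
              (Δ (fun w => F (f w) (mfderiv 𝓘(ℝ, ℂ) (𝓡 4) f w (1 : ℂ)))) z -
            ((fderiv ℝ (fun w => F (f w) (mfderiv 𝓘(ℝ, ℂ) (𝓡 4) f w (1 : ℂ))) z 1) ^ 2 +
              (fderiv ℝ (fun w => F (f w) (mfderiv 𝓘(ℝ, ℂ) (𝓡 4) f w (1 : ℂ))) z Complex.I) ^ 2))) →
    ∃ (Jh : EuclideanSpace ℝ (Fin 4) → EuclideanSpace ℝ (Fin 4) →L[ℝ] EuclideanSpace ℝ (Fin 4))
      (Fh : EuclideanSpace ℝ (Fin 4) → EuclideanSpace ℝ (Fin 4) → ℝ),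
      ContDiffOn ℝ ∞ Jh (Metric.ball (extChartAt (𝓡 4) q q) r₃) ∧
      (∀ x ∈ Metric.ball (extChartAt (𝓡 4) q q) r₃, ∀ v, Jh x (Jh x v) = -v) ∧
      ContDiffOn ℝ ∞ (fun y : (EuclideanSpace ℝ (Fin 4)) × (EuclideanSpace ℝ (Fin 4)) => Fh y.1 y.2)
        ((Metric.ball (extChartAt (𝓡 4) q q) r₃ \ Metric.closedBall (extChartAt (𝓡 4) q q) r₁) ×ˢ
          Set.univ) ∧
      (∀ x ∈ Metric.ball (extChartAt (𝓡 4) q q) r₃ \ Metric.closedBall (extChartAt (𝓡 4) q q) r₁,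
        ∀ v, 0 ≤ Fh x v ∧ (Fh x v = 0 → v = 0)) ∧
      (∀ (U : Set ℂ) (g : ℂ → EuclideanSpace ℝ (Fin 4)), IsOpen U →
        ContDiffOn ℝ ∞ g U →
        (∀ z ∈ U, ∀ ζ : ℂ,
          fderiv ℝ g z (Complex.I * ζ) = Jh (g z) (fderiv ℝ g z ζ)) →
        (∀ z ∈ U, g z ∈
          Metric.ball (extChartAt (𝓡 4) q q) r₃ \ Metric.closedBall (extChartAt (𝓡 4) q q) r₁) →
        ContDiffOn ℝ 2 (fun w => Fh (g w) (fderiv ℝ g w 1)) U ∧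
        ∀ z ∈ U, 2 * c * (Fh (g z) (fderiv ℝ g z 1)) ^ 3 ≤
          Fh (g z) (fderiv ℝ g z 1) * (Δ (fun w => Fh (g w) (fderiv ℝ g w 1))) z -
            ((fderiv ℝ (fun w => Fh (g w) (fderiv ℝ g w 1)) z 1) ^ 2 +
              (fderiv ℝ (fun w => Fh (g w) (fderiv ℝ g w 1)) z Complex.I) ^ 2)) ∧
      (∀ x : ↥(punctured p), x.1 ∈ (chartAt (EuclideanSpace ℝ (Fin 4)) q).source →
        extChartAt (𝓡 4) q x.1 ∈
          Metric.ball (extChartAt (𝓡 4) q q) r₃ →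
        ∀ v : TangentSpace (𝓡 4) x,
          Jh (extChartAt (𝓡 4) q x.1)
            (mfderiv (𝓡 4) 𝓘(ℝ, EuclideanSpace ℝ (Fin 4))
            (fun z : ↥(punctured p) => extChartAt (𝓡 4) q z.1) x v) =
          mfderiv (𝓡 4) 𝓘(ℝ, EuclideanSpace ℝ (Fin 4))
            (fun z : ↥(punctured p) => extChartAt (𝓡 4) q z.1) x (J x v) ∧
          Fh (extChartAt (𝓡 4) q x.1)
            (mfderiv (𝓡 4) 𝓘(ℝ, EuclideanSpace ℝ (Fin 4))
            (fun z : ↥(punctured p) => extChartAt (𝓡 4) q z.1) x v) = F x v) := by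
  intro S p J ε' F c q r₁ r₃ hdata
  classical
  obtain ⟨-, -, hJ2, hJs, -, -, hr₁, hr₁₃, hball, hne, hcore, hFs, hFpos, hcert⟩ := hdata
  -- `J` with flat fibre types (`TangentSpace (𝓡 4) x` is `ℝ⁴` by definition)
  set Jf : ↥(punctured p) → EuclideanSpace ℝ (Fin 4) →L[ℝ] EuclideanSpace ℝ (Fin 4) :=
    fun x => J x
  have hJ2f : ∀ (x : ↥(punctured p)) (v : EuclideanSpace ℝ (Fin 4)), Jf x (Jf x v) = -v :=
    fun x v => hJ2 x v
  -- the interior point `q ≠ p` as a point `q₀` of `Σ ∖ p`, and the chart ball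
  set a : EuclideanSpace ℝ (Fin 4) := extChartAt (𝓡 4) q q with ha
  have hq : q ∈ punctured p := by
    have h := hne a (Metric.mem_closedBall_self (by linarith))
    rw [ha, extChartAt_to_inv] at h
    exact mem_punctured.2 h
  set q₀ : punctured p := ⟨q, hq⟩
  have hsrcN : ∀ x : punctured p, x.1 ∈ (chartAt (EuclideanSpace ℝ (Fin 4)) q).source →
      x ∈ (chartAt (EuclideanSpace ℝ (Fin 4)) q₀).source := fun x hx => by
    rw [TopologicalSpace.Opens.chartAt_eq, OpenPartialHomeomorph.subtypeRestr_source]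
    exact hx
  -- the lift `Φ = e_q⁻¹` on the closed chart ball (the point `q₀` elsewhere)
  set Φ : EuclideanSpace ℝ (Fin 4) → punctured p := fun y =>
    if h : y ∈ Metric.closedBall a r₃ then
      ⟨(extChartAt (𝓡 4) q).symm y, mem_punctured.2 (hne y h)⟩ else q₀ with hΦ_def
  have hΦ : ∀ y ∈ Metric.closedBall a r₃, (Φ y).1 = (extChartAt (𝓡 4) q).symm y :=
    fun y hy => by simp only [hΦ_def, dif_pos hy]
  -- the chart differential `A` and the transported pair
  set A : punctured p → EuclideanSpace ℝ (Fin 4) →L[ℝ] EuclideanSpace ℝ (Fin 4) := fun x =>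
    mfderiv (𝓡 4) 𝓘(ℝ, EuclideanSpace ℝ (Fin 4))
      (fun z : punctured p => extChartAt (𝓡 4) q z.1) x
  have hA : ∀ x, A x = mfderiv (𝓡 4) 𝓘(ℝ, EuclideanSpace ℝ (Fin 4)) (extChartAt (𝓡 4) q₀) x :=
    fun x => rfl
  set Jh : EuclideanSpace ℝ (Fin 4) → EuclideanSpace ℝ (Fin 4) →L[ℝ] EuclideanSpace ℝ (Fin 4) :=
    fun y => A (Φ y) ∘L Jf (Φ y) ∘L (A (Φ y)).inverse
  set Fh : EuclideanSpace ℝ (Fin 4) → EuclideanSpace ℝ (Fin 4) → ℝ :=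
    fun y w => F (Φ y) ((A (Φ y)).inverse w)
  -- the lift is smooth on the closed ball, with values in the chart domain
  have hΦs : ContMDiffOn 𝓘(ℝ, EuclideanSpace ℝ (Fin 4)) (𝓡 4) ∞ Φ (Metric.closedBall a r₃) := by
    intro y hy
    rw [← ContMDiffWithinAt.subtypeVal_comp_iff]
    exact ((contMDiffOn_extChartAt_symm q).mono hball y hy).congr (fun y' hy' => hΦ y' hy')
      (hΦ y hy)
  have hΦat : ∀ y ∈ Metric.ball a r₃, ContMDiffAt 𝓘(ℝ, EuclideanSpace ℝ (Fin 4)) (𝓡 4) ∞ Φ y :=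
    fun y hy => (hΦs y (Metric.ball_subset_closedBall hy)).contMDiffAt
      (mem_of_superset (Metric.isOpen_ball.mem_nhds hy) Metric.ball_subset_closedBall)
  have hΦsrc : ∀ y ∈ Metric.closedBall a r₃,
      (Φ y).1 ∈ (chartAt (EuclideanSpace ℝ (Fin 4)) q).source := fun y hy => by
    rw [hΦ y hy, ← extChartAt_source (I := 𝓡 4)]
    exact (extChartAt (𝓡 4) q).map_target (hball hy)
  have hΦsrcN : ∀ y ∈ Metric.closedBall a r₃,
      Φ y ∈ (chartAt (EuclideanSpace ℝ (Fin 4)) q₀).source := fun y hy => hsrcN _ (hΦsrc y hy)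
  have heΦ : ∀ y ∈ Metric.closedBall a r₃, extChartAt (𝓡 4) q (Φ y).1 = y := fun y hy => by
    rw [hΦ y hy]
    exact (extChartAt (𝓡 4) q).right_inv (hball hy)
  have hAinv : ∀ x : punctured p, x.1 ∈ (chartAt (EuclideanSpace ℝ (Fin 4)) q).source →
      (A x).IsInvertible := fun x hx => by
    rw [hA]
    exact isInvertible_mfderiv_extChartAt (by rw [extChartAt_source]; exact hsrcN x hx)
  refine ⟨Jh, Fh, ?_, ?_, ?_, ?_, ?_, ?_⟩
  · -- `Ĵ` is smooth on the ball
    intro y hy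
    have h1 := contMDiffAt_conj_chartMfderiv hA Jf hJs
      (hΦsrcN y (Metric.ball_subset_closedBall hy))
    exact ((h1.comp y (hΦat y hy)).contDiffAt).contDiffWithinAt
  · -- `Ĵ² = -1` on the ball
    intro y hy v
    have hi := hAinv (Φ y) (hΦsrc y (Metric.ball_subset_closedBall hy))
    show (A (Φ y) ∘L Jf (Φ y) ∘L (A (Φ y)).inverse)
      ((A (Φ y) ∘L Jf (Φ y) ∘L (A (Φ y)).inverse) v) = -v
    simp only [ContinuousLinearMap.coe_comp, Function.comp_apply]
    rw [hi.inverse_apply_self, hJ2f, map_neg, hi.self_apply_inverse]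
  · -- `F̂` is smooth on the shell times `ℝ⁴`
    rintro ⟨y, w⟩ hyw
    have hy : y ∈ Metric.ball a r₃ := hyw.1.1
    exact ((contMDiffAt_apply_inverse_chartMfderiv hA F hFs (hΦat y hy)
      (hΦsrcN y (Metric.ball_subset_closedBall hy)) w).contDiffAt).contDiffWithinAt
  · -- `F̂` is positive definite on the shell
    intro y hy v
    have hi := hAinv (Φ y) (hΦsrc y (Metric.ball_subset_closedBall hy.1))
    refine ⟨(hFpos _ _).1, fun h0 => ?_⟩
    have h1 : (A (Φ y)).inverse v = 0 := (hFpos _ _).2 h0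
    rw [← hi.self_apply_inverse v, h1, map_zero]
  · -- the flat certificate on the shell
    intro U g hU hg hholg hshell
    set f : ℂ → punctured p := fun z => Φ (g z)
    have hgcl : ∀ z ∈ U, g z ∈ Metric.closedBall a r₃ := fun z hz =>
      Metric.ball_subset_closedBall (hshell z hz).1
    have hfU : ContMDiffOn 𝓘(ℝ, ℂ) (𝓡 4) ∞ f U := hΦs.comp hg.contMDiffOn hgcl
    have hfsrc : ∀ z ∈ U, (f z).1 ∈ (chartAt (EuclideanSpace ℝ (Fin 4)) q).source :=
      fun z hz => hΦsrc (g z) (hgcl z hz)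
    have hef : ∀ z ∈ U, extChartAt (𝓡 4) q (f z).1 = g z := fun z hz => heΦ (g z) (hgcl z hz)
    -- chain rule `Dg = A_f ∘ Df` on `U`
    have hchain : ∀ z ∈ U, ∀ ζ : ℂ,
        fderiv ℝ g z ζ = A (f z) (mfderiv 𝓘(ℝ, ℂ) (𝓡 4) f z ζ) := by
      intro z hz ζ
      have hfz : MDifferentiableAt 𝓘(ℝ, ℂ) (𝓡 4) f z :=
        ((hfU z hz).contMDiffAt (hU.mem_nhds hz)).mdifferentiableAt (by simp)
      have hEz : MDifferentiableAt (𝓡 4) 𝓘(ℝ, EuclideanSpace ℝ (Fin 4))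
          (fun x : punctured p => extChartAt (𝓡 4) q x.1) (f z) :=
        (contMDiffAt_extChartAt' (I := 𝓡 4) (n := ∞) (x := q₀)
          (hΦsrcN (g z) (hgcl z hz))).mdifferentiableAt (by simp)
      have hev : g =ᶠ[𝓝 z] ((fun x : punctured p => extChartAt (𝓡 4) q x.1) ∘ f) :=
        Filter.eventuallyEq_of_mem (hU.mem_nhds hz) fun w hw => (hef w hw).symm
      rw [hev.fderiv_eq, ← mfderiv_eq_fderiv, mfderiv_comp z hEz hfz]
      rfl
    -- `f` is `J`-holomorphic on `U`
    have hholf : ∀ z ∈ U, ∀ ζ : ℂ, mfderiv 𝓘(ℝ, ℂ) (𝓡 4) f z (Complex.I * ζ : ℂ) =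
        J (f z) (mfderiv 𝓘(ℝ, ℂ) (𝓡 4) f z (ζ : ℂ)) := by
      intro z hz ζ
      have hi := hAinv (f z) (hfsrc z hz)
      have h := hholg z hz ζ
      rw [hchain z hz, hchain z hz] at h
      have h' : A (f z) (mfderiv 𝓘(ℝ, ℂ) (𝓡 4) f z (Complex.I * ζ : ℂ)) =
          A (f z) (Jf (f z) (mfderiv 𝓘(ℝ, ℂ) (𝓡 4) f z (ζ : ℂ))) := by
        rw [h]
        show (A (f z) ∘L Jf (f z) ∘L (A (f z)).inverse) (A (f z) _) = _
        simp only [ContinuousLinearMap.coe_comp, Function.comp_apply]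
        rw [hi.inverse_apply_self]
      have h'' := congrArg (A (f z)).inverse h'
      rw [hi.inverse_apply_self, hi.inverse_apply_self] at h''
      exact h''
    -- `f` maps into the core and avoids the inner closed ball
    have havoid : ∀ z ∈ U, ¬ InPuncturedChartBall p ε' (f z) := fun z hz =>
      hcore (f z) (hfsrc z hz) (by rw [hef z hz]; exact hgcl z hz)
    have hinner : ∀ z ∈ U, (f z).1 ∈ (chartAt (EuclideanSpace ℝ (Fin 4)) q).source →
        extChartAt (𝓡 4) q (f z).1 ∉ Metric.closedBall a r₁ := fun z hz _ => by
      rw [hef z hz]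
      exact (hshell z hz).2
    obtain ⟨hC2, hineq⟩ := hcert U f hU hfU hholf havoid hinner
    -- the two densities agree on `U`
    have heqOn : EqOn (fun w => Fh (g w) (fderiv ℝ g w 1))
        (fun w => F (f w) (mfderiv 𝓘(ℝ, ℂ) (𝓡 4) f w (1 : ℂ))) U := by
      intro w hw
      have hi := hAinv (f w) (hfsrc w hw)
      show F (f w) ((A (f w)).inverse (fderiv ℝ g w 1)) = _
      rw [hchain w hw, hi.inverse_apply_self]
    refine ⟨hC2.congr heqOn, fun z hz => ?_⟩
    have hev : (fun w => Fh (g w) (fderiv ℝ g w 1)) =ᶠ[𝓝 z]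
        (fun w => F (f w) (mfderiv 𝓘(ℝ, ℂ) (𝓡 4) f w (1 : ℂ))) :=
      Filter.eventuallyEq_of_mem (hU.mem_nhds hz) heqOn
    have h0 : Fh (g z) (fderiv ℝ g z 1) = F (f z) (mfderiv 𝓘(ℝ, ℂ) (𝓡 4) f z (1 : ℂ)) :=
      heqOn hz
    have key := hineq z hz
    rw [← h0, ← (InnerProductSpace.laplacian_congr_nhds hev).eq_of_nhds, ← hev.fderiv_eq] at key
    exact key
  · -- the link with `(J, F)` through `A`
    intro x hx hxball v
    have hΦx : Φ (extChartAt (𝓡 4) q x.1) = x := by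
      apply Subtype.ext
      rw [hΦ _ (Metric.ball_subset_closedBall hxball)]
      exact (extChartAt (𝓡 4) q).left_inv (by rwa [extChartAt_source])
    have hi := hAinv x hx
    constructor
    · show (A (Φ (extChartAt (𝓡 4) q x.1)) ∘L Jf (Φ (extChartAt (𝓡 4) q x.1)) ∘L
        (A (Φ (extChartAt (𝓡 4) q x.1))).inverse) (A x v) = A x (Jf x v)
      rw [hΦx]
      simp only [ContinuousLinearMap.coe_comp, Function.comp_apply]
      rw [hi.inverse_apply_self]
    · show F (Φ (extChartAt (𝓡 4) q x.1)) ((A (Φ (extChartAt (𝓡 4) q x.1))).inverse (A x v)) =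
        F x v
      rw [hΦx, hi.inverse_apply_self]

end Summit.SmoothPoincare4.SmoothPoincare4.Cruxes.HyperbolicEnd.Sketch

end
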